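import Summits.CriticalPhenomena.SAWScalingLimit.Theorems.SAWDevelopingMapHexConjectureKPDefs
import Summits.CriticalPhenomena.SAWScalingLimit.Theorems.SAWDevelopingMapHexConjectureTriDlPos
import HarnessLib

/-!
# Crux `HexConjecture` (stmt-CriticalPhenomena-0808), line `root-locality-replaces-loewner`:
Krachun–Panagiotis Corollary 3.1 — the cap-free form of the two-case recurrence inequality

Landing target:
`Summits/CriticalPhenomena/SAWScalingLimit/Theorems/SAWDevelopingMapHexConjectureKPCor31.lean`
(`--supports stmt-CriticalPhenomena-0808`; registered stub `stub_kp_cor31`).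

Write `a := HV.triDl` (positive, `stub_triDl_pos`; non-increasing, `HV.triDl_antitone`;
`triDl = triDr`, `HV.triDl_eq_triDr`) and `S_N := Σ_{i ≤ N} a i`.  The two constructions (a)/(b) of
[KP, §3.2] give, for every `T ≥ 1` and every pair of admissible renewal caps `M₁ ≥ renCap k`
(`k ∈ [T, 2T)`), `M₂ ≥ renCap i` (`i ∈ [4T, 5T)`), the dichotomy
`ca·T·a(2T)·a(5T) ≤ (1+M₁)·W T ∨ cb·T²·a(2T)·a(5T)·a(9T) ≤ (1+M₁)(1+M₂)·W T`
for the window mass `W T` (`ca = cos(π/8)/(16 cos(π/4))`, `cb = 15/64`).  This file removes the caps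
using ONLY positivity and monotonicity of `a` (no regularity hypothesis), which is the content of
[KP, Corollary 3.1] (`T⁴ D_{18T}⁵ ≤ 2¹⁷ (Σ_{i ≤ 3T} D_i)⁴ Σ_k G_k`):
`∃ Cbig > 0, ∀ T ≥ 1, T⁴·a(9T)⁵ ≤ Cbig·S_{3T}⁴·W T`.

* CAP BOUND (`cor31_renSum_le`, `cor31_renCap_le`): for `m ≤ ⌊(⌊k/2⌋ - 1)/2⌋`,
  `Σ_{i ≤ k} a i · a ⌊(k-i-1)/2⌋ ≤ 4 a(m) S_k` — termwise one of the two indices is `≥ m`, so the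
  product is `≤ a(m)·(a i + a ⌊(k-i-1)/2⌋)`, and `Σ_{j ≤ k} a ⌊(j-1)/2⌋ ≤ 3 S_k` because every
  fibre of `j ↦ ⌊(j-1)/2⌋` has at most three elements (`cor31_sum_half_le`); hence
  `renCap k ≤ 128 cos(π/8)·a(m)·S_N / a(N)` for `k ≤ N`;
* the caps `M₁ := 128 cos(π/8)·a(μ)·S_{2T}/a(2T)` with `μ = ⌊(⌊T/2⌋-1)/2⌋` and
  `M₂ := 128 cos(π/8)·a(T-1)·S_{5T}/a(5T)` are admissible, and `1 + M ≤ (1/a 0 + 128cos(π/8))·…`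
  (`cor31_one_add_mul_le`);
* the ARITHMETIC of monotonicity: `T·a(μ) ≤ 8 S_{3T}` (`T ≤ 8(μ+1)`), `T·a(T-1) ≤ S_{3T}`,
  `T·a(9T) ≤ S_{3T}`, `S_{2T} ≤ S_{3T}`, `S_{5T} ≤ 2 S_{3T}`;
* the pure-real algebra of the two cases (`cor31_caseA`, `cor31_caseB`), giving
  `Cbig = 8C₁/ca + 16C₁²/cb` with `C₁ = 1/a 0 + 128 cos(π/8)`.
Sources: Krachun–Panagiotis, arXiv:2310.17299, §3.2 (Corollary 3.1 and its proof from
Lemmas 3.2–3.3); Glazman–Manolescu 2020, Lemma 4.1 (monotonicity of `D^Δ`).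
-/

noncomputable section

open scoped Classical
open Finset
open Literature.Probability.RandomPlanarGeometry.SAW
open Literature.Probability.RandomPlanarGeometry.SAW.HV

namespace Summit.CriticalPhenomena.SAWScalingLimit.Theorems.HexConjecture.RootLocality

/-- `(n+1)·a n ≤ Σ_{i < N} a i` for `n + 1 ≤ N`: the first `n + 1` terms are each `≥ a n`
(`a = triDl` non-increasing). [cite: GlazmanManolescu2019, Lemma 4.1] -/
theorem cor31_mul_le_sum {n N : ℕ} (h : n + 1 ≤ N) :
    ((n : ℝ) + 1) * triDl n ≤ ∑ i ∈ range N, triDl i := by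
  calc ((n : ℝ) + 1) * triDl n = ∑ _i ∈ range (n + 1), triDl n := by
        rw [sum_const, card_range, nsmul_eq_mul]; push_cast; ring
    _ ≤ ∑ i ∈ range (n + 1), triDl i :=
        sum_le_sum fun i hi => triDl_antitone (by have := mem_range.1 hi; omega)
    _ ≤ ∑ i ∈ range N, triDl i :=
        sum_le_sum_of_subset_of_nonneg (range_mono h) fun i _ _ => triDl_nonneg i

/-- `T·a n ≤ c·Σ_{i < N} a i` whenever `T ≤ c·(n+1)` and `n + 1 ≤ N` (monotonicity only).
[cite: GlazmanManolescu2019, Lemma 4.1] -/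
theorem cor31_nat_mul_le_sum {T n N c : ℕ} (h1 : T ≤ c * (n + 1)) (h2 : n + 1 ≤ N) :
    (T : ℝ) * triDl n ≤ c * ∑ i ∈ range N, triDl i := by
  have e : (T : ℝ) ≤ c * ((n : ℝ) + 1) := by exact_mod_cast h1
  calc (T : ℝ) * triDl n ≤ c * ((n : ℝ) + 1) * triDl n :=
        mul_le_mul_of_nonneg_right e (triDl_nonneg _)
    _ = c * (((n : ℝ) + 1) * triDl n) := by ring
    _ ≤ c * ∑ i ∈ range N, triDl i :=
        mul_le_mul_of_nonneg_left (cor31_mul_le_sum h2) c.cast_nonneg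

/-- `Σ_{i ≤ 5T} a i ≤ 2·Σ_{i ≤ 3T} a i`: the `2T` terms with `3T < i ≤ 5T` are each `≤ a(3T)`, and
`2T·a(3T) ≤ (3T+1)·a(3T) ≤ Σ_{i ≤ 3T} a i`. [cite: GlazmanManolescu2019, Lemma 4.1] -/
theorem cor31_sum_five_le (T : ℕ) :
    ∑ i ∈ range (5 * T + 1), triDl i ≤ 2 * ∑ i ∈ range (3 * T + 1), triDl i := by
  have h3 : ∑ x ∈ range (2 * T), triDl (3 * T + 1 + x) ≤ ∑ i ∈ range (3 * T + 1), triDl i :=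
    calc ∑ x ∈ range (2 * T), triDl (3 * T + 1 + x)
        ≤ ∑ _x ∈ range (2 * T), triDl (3 * T) := sum_le_sum fun x _ => triDl_antitone (by omega)
      _ = ((2 * T : ℕ) : ℝ) * triDl (3 * T) := by rw [sum_const, card_range, nsmul_eq_mul]
      _ ≤ (((3 * T : ℕ) : ℝ) + 1) * triDl (3 * T) :=
          mul_le_mul_of_nonneg_right (by norm_cast; omega) (triDl_nonneg _)
      _ ≤ ∑ i ∈ range (3 * T + 1), triDl i := cor31_mul_le_sum le_rfl
  rw [show 5 * T + 1 = (3 * T + 1) + 2 * T by ring, sum_range_add]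
  linarith

/-- Every fibre of `j ↦ ⌊(j-1)/2⌋` (truncated subtraction) has at most three elements, so
`Σ_{j ≤ k} a ⌊(j-1)/2⌋ ≤ 3·Σ_{i ≤ k} a i`.
[cite: KrachunPanagiotis2026, §3.2 (proof of Corollary 3.1)] -/
theorem cor31_sum_half_le (k : ℕ) :
    ∑ j ∈ range (k + 1), triDl ((j - 1) / 2) ≤ 3 * ∑ i ∈ range (k + 1), triDl i := by
  have hmaps : ∀ j ∈ range (k + 1), (j - 1) / 2 ∈ range (k + 1) := fun j hj => by
    rw [mem_range] at hj ⊢; omega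
  calc ∑ j ∈ range (k + 1), triDl ((j - 1) / 2)
      = ∑ b ∈ range (k + 1), ∑ _j ∈ range (k + 1) with (_j - 1) / 2 = b, triDl b :=
        (sum_fiberwise_of_maps_to' hmaps triDl).symm
    _ ≤ ∑ b ∈ range (k + 1), 3 * triDl b := by
        refine sum_le_sum fun b _ => ?_
        rw [sum_const, nsmul_eq_mul]
        refine mul_le_mul_of_nonneg_right ?_ (triDl_nonneg b)
        have hsub : ((range (k + 1)).filter fun j => (j - 1) / 2 = b) ⊆
            {2 * b, 2 * b + 1, 2 * b + 2} := by
          intro j hj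
          simp only [mem_filter, mem_range] at hj
          simp only [mem_insert, mem_singleton]
          omega
        exact_mod_cast (card_le_card hsub).trans card_le_three
    _ = 3 * ∑ i ∈ range (k + 1), triDl i := by rw [mul_sum]

/-- **The renewal sum without regularity**: for `m ≤ ⌊(⌊k/2⌋-1)/2⌋`,
`Σ_{i ≤ k} a i · a ⌊(k-i-1)/2⌋ ≤ 4·a(m)·Σ_{i ≤ k} a i`.  Termwise one of the two indices is at least
`m` (for `2i ≤ k` the second, for `2i > k` the first), so the product is at most
`a(m)·(a i + a ⌊(k-i-1)/2⌋)`; then reflect `i ↦ k - i` and use `cor31_sum_half_le`.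
[cite: KrachunPanagiotis2026, §3.2 (proof of Corollary 3.1)] -/
theorem cor31_renSum_le {k m : ℕ} (hm : m ≤ (k / 2 - 1) / 2) :
    ∑ i ∈ range (k + 1), triDl i * triDl ((k - i - 1) / 2) ≤
      4 * triDl m * ∑ i ∈ range (k + 1), triDl i := by
  have ham := triDl_nonneg m
  have hterm : ∀ i ∈ range (k + 1), triDl i * triDl ((k - i - 1) / 2) ≤
      triDl m * (triDl i + triDl ((k - i - 1) / 2)) := by
    intro i hi
    have hik : i ≤ k := Nat.lt_succ_iff.1 (mem_range.1 hi)
    have hai := triDl_nonneg i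
    have haj := triDl_nonneg ((k - i - 1) / 2)
    rcases Nat.lt_or_ge k (2 * i) with h2 | h2
    · -- the first index is at least `m`
      have hb : triDl i ≤ triDl m := triDl_antitone (by omega)
      calc triDl i * triDl ((k - i - 1) / 2) ≤ triDl m * triDl ((k - i - 1) / 2) :=
            mul_le_mul_of_nonneg_right hb haj
        _ ≤ triDl m * (triDl i + triDl ((k - i - 1) / 2)) :=
            mul_le_mul_of_nonneg_left (le_add_of_nonneg_left hai) ham
    · -- the second index is at least `m`
      have hb : triDl ((k - i - 1) / 2) ≤ triDl m := triDl_antitone (by omega)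
      calc triDl i * triDl ((k - i - 1) / 2) ≤ triDl i * triDl m :=
            mul_le_mul_of_nonneg_left hb hai
        _ = triDl m * triDl i := mul_comm _ _
        _ ≤ triDl m * (triDl i + triDl ((k - i - 1) / 2)) :=
            mul_le_mul_of_nonneg_left (le_add_of_nonneg_right haj) ham
  have hre : ∑ i ∈ range (k + 1), triDl ((k - i - 1) / 2) =
      ∑ j ∈ range (k + 1), triDl ((j - 1) / 2) := by
    rw [← sum_range_reflect (fun j => triDl ((j - 1) / 2)) (k + 1)]
    exact sum_congr rfl fun i _ => congrArg triDl (by omega)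
  calc ∑ i ∈ range (k + 1), triDl i * triDl ((k - i - 1) / 2)
      ≤ ∑ i ∈ range (k + 1), triDl m * (triDl i + triDl ((k - i - 1) / 2)) := sum_le_sum hterm
    _ = triDl m * (∑ i ∈ range (k + 1), triDl i +
          ∑ i ∈ range (k + 1), triDl ((k - i - 1) / 2)) := by
        rw [← sum_add_distrib, mul_sum]
    _ ≤ triDl m * (∑ i ∈ range (k + 1), triDl i + 3 * ∑ i ∈ range (k + 1), triDl i) := by
        rw [hre]
        exact mul_le_mul_of_nonneg_left (add_le_add le_rfl (cor31_sum_half_le k)) ham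
    _ = 4 * triDl m * ∑ i ∈ range (k + 1), triDl i := by ring

/-- **The renewal bound without regularity**: `renBound k ≤ 16 cos(π/8)·a(m)·Σ_{i ≤ k} a i` for
`m ≤ ⌊(⌊k/2⌋-1)/2⌋`. [cite: KrachunPanagiotis2026, Lemma 3.1 and §3.2 (M_k)] -/
theorem cor31_renBound_le {k m : ℕ} (hm : m ≤ (k / 2 - 1) / 2) :
    renBound k ≤ 16 * Real.cos (Real.pi / 8) * triDl m * ∑ i ∈ range (k + 1), triDl i := by
  have h := cor31_renSum_le hm
  have hc := cos_pi_div_eight_pos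
  have e : renBound k = 4 * Real.cos (Real.pi / 8) *
      ∑ i ∈ range (k + 1), triDl i * triDl ((k - i - 1) / 2) := by
    rw [renBound, mul_sum]
    exact sum_congr rfl fun i _ => by ring
  rw [e]
  calc 4 * Real.cos (Real.pi / 8) * ∑ i ∈ range (k + 1), triDl i * triDl ((k - i - 1) / 2)
      ≤ 4 * Real.cos (Real.pi / 8) * (4 * triDl m * ∑ i ∈ range (k + 1), triDl i) :=
        mul_le_mul_of_nonneg_left h (by positivity)
    _ = _ := by ring

/-- **KP's renewal cap without regularity**, on a window: for `m ≤ ⌊(⌊k/2⌋-1)/2⌋` and `k ≤ N`,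
`renCap k = 8·renBound k / triDr k ≤ 128 cos(π/8)·a(m)·S_N / a(N)` (`triDr = triDl`, `S_k ≤ S_N`,
`a N ≤ a k`). [cite: KrachunPanagiotis2026, §3.2 (M_k)] -/
theorem cor31_renCap_le {k m N : ℕ} (hm : m ≤ (k / 2 - 1) / 2) (hkN : k ≤ N) :
    renCap k ≤
      128 * Real.cos (Real.pi / 8) * triDl m * (∑ i ∈ range (N + 1), triDl i) / triDl N := by
  have hk := stub_triDl_pos k
  have hN := stub_triDl_pos N
  have hc := cos_pi_div_eight_pos
  have hS : ∑ i ∈ range (k + 1), triDl i ≤ ∑ i ∈ range (N + 1), triDl i :=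
    sum_le_sum_of_subset_of_nonneg (range_mono (by omega)) fun i _ _ => triDl_nonneg i
  have hSN : 0 ≤ ∑ i ∈ range (N + 1), triDl i := sum_nonneg fun i _ => triDl_nonneg i
  have hB := cor31_renBound_le hm
  have h16 : 0 ≤ 16 * Real.cos (Real.pi / 8) * triDl m :=
    mul_nonneg (mul_nonneg (by norm_num) hc.le) (triDl_nonneg m)
  have h8 : (0 : ℝ) ≤ 8 := by norm_num
  rw [renCap, ← triDl_eq_triDr, div_le_iff₀ hk, div_mul_eq_mul_div, le_div_iff₀ hN]
  calc 8 * renBound k * triDl N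
      ≤ 8 * (16 * Real.cos (Real.pi / 8) * triDl m * ∑ i ∈ range (k + 1), triDl i) * triDl N :=
        mul_le_mul_of_nonneg_right (mul_le_mul_of_nonneg_left hB h8) hN.le
    _ ≤ 8 * (16 * Real.cos (Real.pi / 8) * triDl m * ∑ i ∈ range (N + 1), triDl i) * triDl k :=
        mul_le_mul (mul_le_mul_of_nonneg_left (mul_le_mul_of_nonneg_left hS h16) h8)
          (triDl_antitone hkN) hN.le (mul_nonneg h8 (mul_nonneg h16 hSN))
    _ = _ := by ring

/-- Absorbing the `1 +` of a cap: if `a₂ ≤ aμ` and `a₀ ≤ S` then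
`(1 + C₀·aμ·S/a₂)·a₂ ≤ (1/a₀ + C₀)·aμ·S`.
[cite: KrachunPanagiotis2026, §3.2 (proof of Corollary 3.1)] -/
theorem cor31_one_add_mul_le {C₀ a₀ aμ a₂ S : ℝ} (ha₀ : 0 < a₀) (ha₂ : 0 < a₂) (h₂μ : a₂ ≤ aμ)
    (h₀S : a₀ ≤ S) :
    (1 + C₀ * aμ * S / a₂) * a₂ ≤ (1 / a₀ + C₀) * aμ * S := by
  have h1 : a₂ * a₀ ≤ aμ * S := mul_le_mul h₂μ h₀S ha₀.le (ha₂.le.trans h₂μ)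
  have e : (1 + C₀ * aμ * S / a₂) * a₂ = a₂ + C₀ * aμ * S := by
    rw [add_mul, one_mul, div_mul_cancel₀ _ ha₂.ne']
  have e' : (1 / a₀ + C₀) * aμ * S = aμ * S / a₀ + C₀ * aμ * S := by ring
  rw [e, e', add_le_add_iff_right, le_div_iff₀ ha₀]
  exact h1

/-- The algebra of case (a): from `ca·t·a₂·a₅ ≤ (1+M)·w`, `(1+M)·a₂ ≤ C₁·aμ·S₂`, `t·aμ ≤ 8S₃`,
`t·a₉ ≤ S₃`, `S₂ ≤ S₃` and `a₉ ≤ a₅ ≤ a₂`, multiplying by `t³a₉⁵a₂` and cancelling `ca·a₂²·a₅ > 0`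
gives `t⁴a₉⁵ ≤ (8C₁/ca)·S₃⁴·w`.
[cite: KrachunPanagiotis2026, §3.2 (proof of Corollary 3.1, case of Lemma 3.2)] -/
theorem cor31_caseA {ca C₁ t aμ a₂ a₅ a₉ S₂ S₃ w M : ℝ}
    (hca : 0 < ca) (ha₂ : 0 < a₂) (ha₅ : 0 < a₅) (ha₉ : 0 ≤ a₉) (hw : 0 ≤ w) (ht : 0 ≤ t)
    (hC₁ : 0 ≤ C₁) (hS₃ : 0 ≤ S₃) (h₉₅ : a₉ ≤ a₅) (h₅₂ : a₅ ≤ a₂)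
    (hμ : t * aμ ≤ 8 * S₃) (h₉ : t * a₉ ≤ S₃) (hS : S₂ ≤ S₃) (hS₂ : 0 ≤ S₂)
    (hone : (1 + M) * a₂ ≤ C₁ * aμ * S₂) (h : ca * t * a₂ * a₅ ≤ (1 + M) * w) :
    t ^ 4 * a₉ ^ 5 ≤ 8 * C₁ / ca * S₃ ^ 4 * w := by
  have hca' := hca.ne'
  have h₉₂ : a₉ ≤ a₂ := h₉₅.trans h₅₂
  have hcube : a₉ ^ 3 ≤ a₂ ^ 2 * a₅ := by
    calc a₉ ^ 3 = a₉ ^ 2 * a₉ := by ring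
      _ ≤ a₂ ^ 2 * a₅ := mul_le_mul (pow_le_pow_left₀ ha₉ h₉₂ 2) h₉₅ ha₉ (by positivity)
  have key : (ca * a₂ ^ 2 * a₅) * (t ^ 4 * a₉ ^ 5) ≤
      (ca * a₂ ^ 2 * a₅) * (8 * C₁ / ca * S₃ ^ 4 * w) := by
    calc (ca * a₂ ^ 2 * a₅) * (t ^ 4 * a₉ ^ 5)
        = (t ^ 3 * a₉ ^ 5 * a₂) * (ca * t * a₂ * a₅) := by ring
      _ ≤ (t ^ 3 * a₉ ^ 5 * a₂) * ((1 + M) * w) := mul_le_mul_of_nonneg_left h (by positivity)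
      _ = (t ^ 3 * a₉ ^ 5 * w) * ((1 + M) * a₂) := by ring
      _ ≤ (t ^ 3 * a₉ ^ 5 * w) * (C₁ * aμ * S₂) := mul_le_mul_of_nonneg_left hone (by positivity)
      _ = C₁ * (t * aμ) * (t * a₉) ^ 2 * S₂ * (a₉ ^ 3 * w) := by ring
      _ ≤ C₁ * (8 * S₃) * S₃ ^ 2 * S₃ * (a₉ ^ 3 * w) := by
          have h1 : (t * a₉) ^ 2 ≤ S₃ ^ 2 := pow_le_pow_left₀ (by positivity) h₉ 2
          have h2 : C₁ * (t * aμ) ≤ C₁ * (8 * S₃) := mul_le_mul_of_nonneg_left hμ hC₁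
          have h3 : C₁ * (t * aμ) * (t * a₉) ^ 2 ≤ C₁ * (8 * S₃) * S₃ ^ 2 :=
            mul_le_mul h2 h1 (by positivity) (by positivity)
          have h4 : C₁ * (t * aμ) * (t * a₉) ^ 2 * S₂ ≤ C₁ * (8 * S₃) * S₃ ^ 2 * S₃ :=
            mul_le_mul h3 hS hS₂ (by positivity)
          exact mul_le_mul_of_nonneg_right h4 (by positivity)
      _ = (8 * C₁ * S₃ ^ 4 * w) * a₉ ^ 3 := by ring
      _ ≤ (8 * C₁ * S₃ ^ 4 * w) * (a₂ ^ 2 * a₅) := mul_le_mul_of_nonneg_left hcube (by positivity)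
      _ = (ca * a₂ ^ 2 * a₅) * (8 * C₁ / ca * S₃ ^ 4 * w) := by field_simp
  exact le_of_mul_le_mul_left key (by positivity)

/-- The algebra of case (b): from `cb·t²·a₂·a₅·a₉ ≤ (1+M₁)(1+M₂)·w`, `(1+M₁)·a₂ ≤ C₁·aμ·S₂`,
`(1+M₂)·a₅ ≤ C₁·aT·S₅`, `t·aμ ≤ 8S₃`, `t·aT ≤ S₃`, `S₂ ≤ S₃`, `S₅ ≤ 2S₃` and `a₉ ≤ a₅ ≤ a₂`,
multiplying by `t²a₉⁴a₂a₅` and cancelling `cb·a₂²·a₅² > 0` gives `t⁴a₉⁵ ≤ (16C₁²/cb)·S₃⁴·w`.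
[cite: KrachunPanagiotis2026, §3.2 (proof of Corollary 3.1, case of Lemma 3.3)] -/
theorem cor31_caseB {cb C₁ t aμ aT a₂ a₅ a₉ S₂ S₅ S₃ w M₁ M₂ : ℝ}
    (hcb : 0 < cb) (ha₂ : 0 < a₂) (ha₅ : 0 < a₅) (ha₉ : 0 ≤ a₉) (hw : 0 ≤ w) (ht : 0 ≤ t)
    (hC₁ : 0 ≤ C₁) (hS₃ : 0 ≤ S₃) (haμ : 0 ≤ aμ) (haT : 0 ≤ aT) (hS₂ : 0 ≤ S₂) (hS₅ : 0 ≤ S₅)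
    (hM₂ : 0 ≤ M₂) (h₉₅ : a₉ ≤ a₅) (h₅₂ : a₅ ≤ a₂)
    (hμ : t * aμ ≤ 8 * S₃) (hT : t * aT ≤ S₃) (hS₂₃ : S₂ ≤ S₃) (hS₅₃ : S₅ ≤ 2 * S₃)
    (hone₁ : (1 + M₁) * a₂ ≤ C₁ * aμ * S₂) (hone₂ : (1 + M₂) * a₅ ≤ C₁ * aT * S₅)
    (h : cb * t ^ 2 * a₂ * a₅ * a₉ ≤ (1 + M₁) * (1 + M₂) * w) :
    t ^ 4 * a₉ ^ 5 ≤ 16 * C₁ ^ 2 / cb * S₃ ^ 4 * w := by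
  have hcb' := hcb.ne'
  have h₉₂ : a₉ ≤ a₂ := h₉₅.trans h₅₂
  have hfour : a₉ ^ 4 ≤ a₂ ^ 2 * a₅ ^ 2 := by
    calc a₉ ^ 4 = a₉ ^ 2 * a₉ ^ 2 := by ring
      _ ≤ a₂ ^ 2 * a₅ ^ 2 := mul_le_mul (pow_le_pow_left₀ ha₉ h₉₂ 2) (pow_le_pow_left₀ ha₉ h₉₅ 2)
          (by positivity) (by positivity)
  have key : (cb * a₂ ^ 2 * a₅ ^ 2) * (t ^ 4 * a₉ ^ 5) ≤
      (cb * a₂ ^ 2 * a₅ ^ 2) * (16 * C₁ ^ 2 / cb * S₃ ^ 4 * w) := by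
    calc (cb * a₂ ^ 2 * a₅ ^ 2) * (t ^ 4 * a₉ ^ 5)
        = (t ^ 2 * a₉ ^ 4 * a₂ * a₅) * (cb * t ^ 2 * a₂ * a₅ * a₉) := by ring
      _ ≤ (t ^ 2 * a₉ ^ 4 * a₂ * a₅) * ((1 + M₁) * (1 + M₂) * w) :=
          mul_le_mul_of_nonneg_left h (by positivity)
      _ = (t ^ 2 * a₉ ^ 4 * w) * (((1 + M₁) * a₂) * ((1 + M₂) * a₅)) := by ring
      _ ≤ (t ^ 2 * a₉ ^ 4 * w) * ((C₁ * aμ * S₂) * (C₁ * aT * S₅)) :=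
          mul_le_mul_of_nonneg_left (mul_le_mul hone₁ hone₂ (by positivity) (by positivity))
            (by positivity)
      _ = C₁ ^ 2 * ((t * aμ) * (t * aT)) * (S₂ * S₅) * (a₉ ^ 4 * w) := by ring
      _ ≤ C₁ ^ 2 * ((8 * S₃) * S₃) * (S₃ * (2 * S₃)) * (a₉ ^ 4 * w) := by
          have h1 : (t * aμ) * (t * aT) ≤ (8 * S₃) * S₃ :=
            mul_le_mul hμ hT (by positivity) (by positivity)
          have h2 : S₂ * S₅ ≤ S₃ * (2 * S₃) := mul_le_mul hS₂₃ hS₅₃ hS₅ hS₃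
          have h3 : C₁ ^ 2 * ((t * aμ) * (t * aT)) ≤ C₁ ^ 2 * ((8 * S₃) * S₃) :=
            mul_le_mul_of_nonneg_left h1 (by positivity)
          have h4 : C₁ ^ 2 * ((t * aμ) * (t * aT)) * (S₂ * S₅) ≤
              C₁ ^ 2 * ((8 * S₃) * S₃) * (S₃ * (2 * S₃)) :=
            mul_le_mul h3 h2 (by positivity) (by positivity)
          exact mul_le_mul_of_nonneg_right h4 (by positivity)
      _ = (16 * C₁ ^ 2 * S₃ ^ 4 * w) * a₉ ^ 4 := by ring
      _ ≤ (16 * C₁ ^ 2 * S₃ ^ 4 * w) * (a₂ ^ 2 * a₅ ^ 2) :=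
          mul_le_mul_of_nonneg_left hfour (by positivity)
      _ = (cb * a₂ ^ 2 * a₅ ^ 2) * (16 * C₁ ^ 2 / cb * S₃ ^ 4 * w) := by field_simp
  exact le_of_mul_le_mul_left key (by positivity)

/-- **Corollary 3.1 of Krachun–Panagiotis, abstract form**: from the two-case recurrence inequality
with arbitrary admissible renewal caps (constants `ca, cb > 0`, window mass `W ≥ 0`), using only
positivity and monotonicity of `a = triDl`:
`∃ Cbig > 0, ∀ T ≥ 1, T⁴·a(9T)⁵ ≤ Cbig·(Σ_{i ≤ 3T} a i)⁴·W T`.  The caps are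
`M₁ = 128cos(π/8)·a(μ)·S_{2T}/a(2T)` (`μ = ⌊(⌊T/2⌋-1)/2⌋`), `M₂ = 128cos(π/8)·a(T-1)·S_{5T}/a(5T)`
(`cor31_renCap_le`), and `Cbig = 8C₁/ca + 16C₁²/cb` with `C₁ = 1/a 0 + 128cos(π/8)`.
[cite: KrachunPanagiotis2026, Corollary 3.1] -/
theorem cor31_of_dichotomy {ca cb : ℝ} (hca : 0 < ca) (hcb : 0 < cb) {W : ℕ → ℝ}
    (hW : ∀ T : ℕ, 1 ≤ T → ∀ M₁ M₂ : ℝ, (∀ k : ℕ, T ≤ k → k < 2 * T → renCap k ≤ M₁) →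
      (∀ i : ℕ, 4 * T ≤ i → i < 5 * T → renCap i ≤ M₂) →
      ca * (T : ℝ) * triDl (2 * T) * triDl (5 * T) ≤ (1 + M₁) * W T ∨
      cb * (T : ℝ) ^ 2 * triDl (2 * T) * triDl (5 * T) * triDl (9 * T) ≤
        (1 + M₁) * (1 + M₂) * W T)
    (hW0 : ∀ T : ℕ, 0 ≤ W T) :
    ∃ Cbig : ℝ, 0 < Cbig ∧ ∀ T : ℕ, 1 ≤ T →
      (T : ℝ) ^ 4 * triDl (9 * T) ^ 5 ≤ Cbig * (∑ i ∈ range (3 * T + 1), triDl i) ^ 4 * W T := by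
  have ha₀ := stub_triDl_pos 0
  have hc := cos_pi_div_eight_pos
  have h128 : (0 : ℝ) ≤ 128 * Real.cos (Real.pi / 8) := mul_nonneg (by norm_num) hc.le
  -- the constant absorbing the `1 +` of the caps
  obtain ⟨C₁, hC₁0, hC₁⟩ : ∃ C₁ : ℝ, 0 < C₁ ∧ C₁ = 1 / triDl 0 + 128 * Real.cos (Real.pi / 8) :=
    ⟨_, add_pos_of_pos_of_nonneg (one_div_pos.2 ha₀) h128, rfl⟩
  refine ⟨8 * C₁ / ca + 16 * C₁ ^ 2 / cb,
    add_pos (div_pos (mul_pos (by norm_num) hC₁0) hca)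
      (div_pos (mul_pos (by norm_num) (pow_pos hC₁0 2)) hcb), fun T hT => ?_⟩
  have hA : 0 ≤ 8 * C₁ / ca := (div_pos (mul_pos (by norm_num) hC₁0) hca).le
  have hB : 0 ≤ 16 * C₁ ^ 2 / cb := (div_pos (mul_pos (by norm_num) (pow_pos hC₁0 2)) hcb).le
  set S₃ : ℝ := ∑ i ∈ range (3 * T + 1), triDl i
  have hS₃0 : 0 ≤ S₃ := sum_nonneg fun i _ => triDl_nonneg i
  have hT0 : (0 : ℝ) ≤ T := T.cast_nonneg
  have h2 := stub_triDl_pos (2 * T)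
  have h5 := stub_triDl_pos (5 * T)
  have h95 : triDl (9 * T) ≤ triDl (5 * T) := triDl_antitone (by omega)
  have h52 : triDl (5 * T) ≤ triDl (2 * T) := triDl_antitone (by omega)
  have hS₂0 : 0 ≤ ∑ i ∈ range (2 * T + 1), triDl i := sum_nonneg fun i _ => triDl_nonneg i
  have hS₅0 : 0 ≤ ∑ i ∈ range (5 * T + 1), triDl i := sum_nonneg fun i _ => triDl_nonneg i
  -- the admissible caps `M₁`, `M₂`
  have hcap₁ : ∀ k : ℕ, T ≤ k → k < 2 * T → renCap k ≤
      128 * Real.cos (Real.pi / 8) * triDl ((T / 2 - 1) / 2) *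
        (∑ i ∈ range (2 * T + 1), triDl i) / triDl (2 * T) :=
    fun k hk₁ hk₂ => cor31_renCap_le (by omega) (by omega)
  have hcap₂ : ∀ i : ℕ, 4 * T ≤ i → i < 5 * T → renCap i ≤
      128 * Real.cos (Real.pi / 8) * triDl (T - 1) *
        (∑ i ∈ range (5 * T + 1), triDl i) / triDl (5 * T) :=
    fun i hi₁ hi₂ => cor31_renCap_le (by omega) (by omega)
  have hM₂ : 0 ≤ 128 * Real.cos (Real.pi / 8) * triDl (T - 1) *
      (∑ i ∈ range (5 * T + 1), triDl i) / triDl (5 * T) :=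
    div_nonneg (mul_nonneg (mul_nonneg h128 (triDl_nonneg _)) hS₅0) (triDl_nonneg _)
  -- absorbing the `1 +`
  have h0₂ : triDl 0 ≤ ∑ i ∈ range (2 * T + 1), triDl i :=
    single_le_sum (f := triDl) (fun i _ => triDl_nonneg i) (mem_range.2 (by omega))
  have h0₅ : triDl 0 ≤ ∑ i ∈ range (5 * T + 1), triDl i :=
    single_le_sum (f := triDl) (fun i _ => triDl_nonneg i) (mem_range.2 (by omega))
  have hone₁ := cor31_one_add_mul_le (C₀ := 128 * Real.cos (Real.pi / 8)) ha₀ h2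
    (triDl_antitone (show (T / 2 - 1) / 2 ≤ 2 * T by omega)) h0₂
  have hone₂ := cor31_one_add_mul_le (C₀ := 128 * Real.cos (Real.pi / 8)) ha₀ h5
    (triDl_antitone (show T - 1 ≤ 5 * T by omega)) h0₅
  rw [← hC₁] at hone₁ hone₂
  -- the arithmetic of monotonicity
  have hμ : (T : ℝ) * triDl ((T / 2 - 1) / 2) ≤ 8 * S₃ := by
    exact_mod_cast cor31_nat_mul_le_sum (c := 8)
      (show T ≤ 8 * ((T / 2 - 1) / 2 + 1) by omega) (show (T / 2 - 1) / 2 + 1 ≤ 3 * T + 1 by omega)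
  have hT1 : (T : ℝ) * triDl (T - 1) ≤ S₃ := by
    simpa using cor31_nat_mul_le_sum (c := 1)
      (show T ≤ 1 * (T - 1 + 1) by omega) (show T - 1 + 1 ≤ 3 * T + 1 by omega)
  have h9 : (T : ℝ) * triDl (9 * T) ≤ S₃ :=
    calc (T : ℝ) * triDl (9 * T) ≤ (T : ℝ) * triDl T :=
          mul_le_mul_of_nonneg_left (triDl_antitone (by omega)) hT0
      _ ≤ S₃ := by
          simpa using cor31_nat_mul_le_sum (c := 1)
            (show T ≤ 1 * (T + 1) by omega) (show T + 1 ≤ 3 * T + 1 by omega)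
  have hS23 : ∑ i ∈ range (2 * T + 1), triDl i ≤ S₃ :=
    sum_le_sum_of_subset_of_nonneg (range_mono (by omega)) fun i _ _ => triDl_nonneg i
  have hS53 : ∑ i ∈ range (5 * T + 1), triDl i ≤ 2 * S₃ := cor31_sum_five_le T
  have hSW : 0 ≤ S₃ ^ 4 * W T := mul_nonneg (pow_nonneg hS₃0 4) (hW0 T)
  -- the dichotomy with the chosen caps
  rcases hW T hT _ _ hcap₁ hcap₂ with h | h
  · calc (T : ℝ) ^ 4 * triDl (9 * T) ^ 5 ≤ 8 * C₁ / ca * S₃ ^ 4 * W T :=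
          cor31_caseA hca h2 h5 (triDl_nonneg _) (hW0 T) hT0 hC₁0.le hS₃0 h95 h52 hμ h9 hS23 hS₂0
            hone₁ h
      _ ≤ (8 * C₁ / ca + 16 * C₁ ^ 2 / cb) * S₃ ^ 4 * W T := by
          rw [mul_assoc, mul_assoc]
          exact mul_le_mul_of_nonneg_right (le_add_of_nonneg_right hB) hSW
  · calc (T : ℝ) ^ 4 * triDl (9 * T) ^ 5 ≤ 16 * C₁ ^ 2 / cb * S₃ ^ 4 * W T :=
          cor31_caseB hcb h2 h5 (triDl_nonneg _) (hW0 T) hT0 hC₁0.le hS₃0 (triDl_nonneg _)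
            (triDl_nonneg _) hS₂0 hS₅0 hM₂ h95 h52 hμ hT1 hS23 hS53 hone₁ hone₂ h
      _ ≤ (8 * C₁ / ca + 16 * C₁ ^ 2 / cb) * S₃ ^ 4 * W T := by
          rw [mul_assoc, mul_assoc]
          exact mul_le_mul_of_nonneg_right (le_add_of_nonneg_left hA) hSW

/-- **Registered sub-goal `stub_kp_cor31`** (crux item stmt-CriticalPhenomena-0808, line
`root-locality-replaces-loewner`): Krachun–Panagiotis's Corollary 3.1 in the tree's variables.
From the two-case recurrence inequality of constructions (a)/(b) — valid for every `T ≥ 1` and all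
admissible renewal caps `M₁ ≥ renCap k` (`k ∈ [T, 2T)`), `M₂ ≥ renCap i` (`i ∈ [4T, 5T)`) — the
coded window floor-arch mass `W T` of the box `S_{32T+1,32T+1}` at offsets `d ∈ [T, 21T]` satisfies
the CAP-FREE bound `T⁴·triDl(9T)⁵ ≤ Cbig·(Σ_{i ≤ 3T} triDl i)⁴·W T`, by positivity and
monotonicity of `triDl` alone (`cor31_of_dichotomy` with `ca = cos(π/8)/(16cos(π/4))`,
`cb = 15/64`, `W T ≥ 0` termwise).
[cite: KrachunPanagiotis2026, Corollary 3.1] -/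
theorem stub_kp_cor31 : (∀ (T : ℕ), 1 ≤ T → ∀ (M₁ M₂ : ℝ), (∀ k : ℕ, T ≤ k → k < 2 * T → renCap k ≤ M₁) → (∀ i : ℕ, 4 * T ≤ i → i < 5 * T → renCap i ≤ M₂) → Real.cos (Real.pi / 8) / (16 * Real.cos (Real.pi / 4)) * (T : ℝ) * Literature.Probability.RandomPlanarGeometry.SAW.HV.triDl (2 * T) * Literature.Probability.RandomPlanarGeometry.SAW.HV.triDl (5 * T) ≤ (1 + M₁) * ∑ d ∈ Finset.Icc (T : ℤ) (21 * T), ∑ P ∈ (Literature.Probability.RandomPlanarGeometry.SAW.HV.midWalks (Literature.Probability.RandomPlanarGeometry.SAW.HV.stripV (32 * T + 1) (32 * T + 1))).filter (fun P => Literature.Probability.RandomPlanarGeometry.SAW.HV.finalDart P = ((d, 0, false), (d, -1, true)) ∨ Literature.Probability.RandomPlanarGeometry.SAW.HV.finalDart P = ((d, -1, true), (d, 0, false))), Literature.Probability.RandomPlanarGeometry.SAW.hexCriticalFugacity ^ Literature.Probability.RandomPlanarGeometry.SAW.HV.mwLen P ∨ (15 / 64 : ℝ) * (T : ℝ) ^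 2 * Literature.Probability.RandomPlanarGeometry.SAW.HV.triDl (2 * T) * Literature.Probability.RandomPlanarGeometry.SAW.HV.triDl (5 * T) * Literature.Probability.RandomPlanarGeometry.SAW.HV.triDl (9 * T) ≤ (1 + M₁) * (1 + M₂) * ∑ d ∈ Finset.Icc (T : ℤ) (21 * T), ∑ P ∈ (Literature.Probability.RandomPlanarGeometry.SAW.HV.midWalks (Literature.Probability.RandomPlanarGeometry.SAW.HV.stripV (32 * T + 1) (32 * T + 1))).filter (fun P => Literature.Probability.RandomPlanarGeometry.SAW.HV.finalDart P = ((d, 0, false), (d, -1, true)) ∨ Literature.Probability.RandomPlanarGeometry.SAW.HV.finalDart P = ((d, -1, true), (d, 0, false))), Literature.Probability.RandomPlanarGeometry.SAW.hexCriticalFugacity ^ Literature.Probability.RandomPlanarGeometry.SAW.HV.mwLen P) → ∃ Cbig : ℝ, 0 < Cbig ∧ ∀ (T : ℕ), 1 ≤ T → (T : ℝ) ^ 4 * Literature.Probability.RandomPlanarGeometry.SAW.HV.triDl (9 * T) ^ 5 ≤ Cbig * (∑ i ∈ Finset.range (3 * T + 1), Literature.Probability.RandomPlanarGeometry.SAW.HV.triDl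 i) ^ 4 * ∑ d ∈ Finset.Icc (T : ℤ) (21 * T), ∑ P ∈ (Literature.Probability.RandomPlanarGeometry.SAW.HV.midWalks (Literature.Probability.RandomPlanarGeometry.SAW.HV.stripV (32 * T + 1) (32 * T + 1))).filter (fun P => Literature.Probability.RandomPlanarGeometry.SAW.HV.finalDart P = ((d, 0, false), (d, -1, true)) ∨ Literature.Probability.RandomPlanarGeometry.SAW.HV.finalDart P = ((d, -1, true), (d, 0, false))), Literature.Probability.RandomPlanarGeometry.SAW.hexCriticalFugacity ^ Literature.Probability.RandomPlanarGeometry.SAW.HV.mwLen P := by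
  intro h
  have hca : 0 < Real.cos (Real.pi / 8) / (16 * Real.cos (Real.pi / 4)) :=
    div_pos cos_pi_div_eight_pos (mul_pos (by norm_num) cos_pi_div_four_pos')
  have hcb : (0 : ℝ) < 15 / 64 := by norm_num
  exact cor31_of_dichotomy hca hcb h fun T => sum_nonneg fun _ _ => sum_nonneg fun _ _ =>
    pow_nonneg hexCriticalFugacity_pos_lt_one.1.le _

end Summit.CriticalPhenomena.SAWScalingLimit.Theorems.HexConjecture.RootLocality

end
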